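import Literature.Algebra.Homology.DiscreteRepInflationQuotient
import Literature.Algebra.Homology.DiscreteRepOpenSubgroup

/-!
# Inflation commutes with coinduction of the trivial module: `Inf_{Γ/N}^{Γ} ℤ[(Γ/N)/U] ≅ ℤ[Γ/Ũ]`
# (`Ũ` the preimage of `U`), and the resulting Shapiro isomorphism
# `Extⁿ_{C_Γ}(Inf Coind_U^{Γ/N} k, Y) = Hⁿ(Ũ, Y)`

Topic `Algebra/Homology`; namespace `Literature.Algebra.Homology.DiscreteRep`.  Sequel of
`DiscreteRepInflationQuotient` (-w7 g11: `inflQuotFunctor k N : C_{Γ/N} ⥤ C_Γ`) and door-c4's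
`DiscreteRepOpenSubgroup` (`coindD U hU : C_U ⥤ C_Γ` for `U` open of finite index, Shapiro
`extCoindResAddEquiv`).  One definition with body (the isomorphism) and theorems; no named fact, no instance,
no `sorry`.

For a topological group `Γ`, a normal subgroup `N`, and an open subgroup of finite index `U ≤ Γ ⧸ N` with
preimage `Ũ = U.comap (Γ → Γ/N)` (open, same index):
* `inflCoindDTrivIso N U hU : (inflQuotFunctor k N).obj (coindD U hU (triv k)) ≅ coindD Ũ _ (triv k)` — the
  permutation module `k[(Γ/N)/U]`, inflated to `Γ`, IS the permutation module `k[Γ/Ũ]`: on vectors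
  `f ↦ f ∘ (Γ → Γ/N)` (a left-`U`-invariant function on `Γ/N` becomes a left-`Ũ`-invariant function on `Γ`;
  the inverse descends a left-`Ũ`-invariant function, which is `N`-invariant because `N ≤ Ũ` is normal);
* `ext_inflQuot_coindD_triv_eq_zero_of_forall` — hence `Extⁿ_{C_Γ}(Inf Coind_U k, Y) = 0` as soon as
  `Extⁿ_{C_Ũ}(k, Res_Ũ Y) = 0` (Shapiro over `Γ`, Harari Prop. 1.39 / Remark 16.13).

Written for the background lane «PT-Ш-S-TC» of crux `stmt-BirchSwinnertonDyer-19032` (cell bsd-eis, seat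
bsd-line-x1-p1-w3 gen 18, brick E3 of -w4 g20's permutation dévissage: `H¹(U, Ī_S) = 0` for `U ≤ G_S = Γ_K/N_S`
open is moved to the open subgroup `Ũ ≤ Γ_K`, where the idèle Hilbert 90 lives).  HONEST FRAMING: bookkeeping
of permutation modules; nothing arithmetic is proved here.

## References
* D. Harari, *Galois Cohomology and Class Field Theory*, Universitext (2020), §1.2 (induced modules),
  Proposition 1.39, §4.3 Remark 4.24 (inflation), Remark 16.13. [Harari2020]
* J.-P. Serre, *Galois Cohomology*, Springer (1997), I §2.5. [SerreGaloisCohomology1997]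
-/

noncomputable section

universe u

namespace Literature.Algebra.Homology

namespace DiscreteRep

open CategoryTheory CategoryTheory.Limits CategoryTheory.Abelian

section Vectors

variable {k Γ : Type u} [CommRing k] [Group Γ] [TopologicalSpace Γ] (N : Subgroup Γ) [N.Normal]
  (U : Subgroup (Γ ⧸ N))

/-! ## §1 The preimage subgroup `Ũ` -/

/-- The preimage `Ũ ≤ Γ` of `U ≤ Γ ⧸ N`. [cite: Harari2020, §4.3 Remark 4.24] -/
abbrev comapQuot : Subgroup Γ := U.comap (QuotientGroup.mk' N)

omit [TopologicalSpace Γ] in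
/-- `Ũ` has the same (finite) index as `U`. [cite: Harari2020, §1.2] -/
theorem finiteIndex_comapQuot [U.FiniteIndex] : (comapQuot N U).FiniteIndex :=
  ⟨by
    rw [comapQuot, Subgroup.index_comap_of_surjective _ (QuotientGroup.mk'_surjective N)]
    exact Subgroup.FiniteIndex.index_ne_zero⟩

omit [TopologicalSpace Γ] in
/-- `N ≤ Ũ`. [cite: Harari2020, §4.3 Remark 4.24] -/
theorem le_comapQuot : N ≤ comapQuot N U := fun n hn => by
  change (QuotientGroup.mk' N n) ∈ U
  rw [QuotientGroup.mk'_apply, (QuotientGroup.eq_one_iff n).2 hn]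
  exact U.one_mem

/-! ## §2 The vectors: `U`-invariant functions on `Γ/N` versus `Ũ`-invariant functions on `Γ` -/

omit [CommRing k] [TopologicalSpace Γ] in
/-- A left-`Ũ`-invariant function on `Γ` is constant on `N`-cosets (for `N` normal, `a N = N a ⊆ Ũ a`).
[cite: Harari2020, §1.2] -/
theorem apply_eq_of_leftRel (g : Γ → k)
    (hg : ∀ (u : comapQuot N U) (y : Γ), g ((u : Γ) * y) = g y) {a b : Γ} (hab : (QuotientGroup.leftRel N) a b) :
    g a = g b := by
  rw [QuotientGroup.leftRel_apply] at hab
  -- `b = a * (a⁻¹ * b) = (a (a⁻¹ b) a⁻¹) * a` with `a (a⁻¹ b) a⁻¹ ∈ N ≤ Ũ`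
  have hn : a * (a⁻¹ * b) * a⁻¹ ∈ comapQuot N U :=
    le_comapQuot N U (Subgroup.Normal.conj_mem inferInstance _ hab a)
  have hb : b = (a * (a⁻¹ * b) * a⁻¹) * a := by group
  conv_rhs => rw [hb]
  exact (hg ⟨_, hn⟩ a).symm

/-- **The linear isomorphism on vectors**: `coindV U (triv) ≃ₗ coindV Ũ (triv)`, `f ↦ f ∘ (Γ → Γ/N)`.
[cite: Harari2020, §1.2 and §4.3 Remark 4.24] -/
def inflCoindTrivLinearEquiv :
    Representation.coindV U.subtype (triv (k := k) (Γ := U) k).obj.ρ ≃ₗ[k]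
      Representation.coindV (comapQuot N U).subtype (triv (k := k) (Γ := comapQuot N U) k).obj.ρ where
  toFun f := ⟨fun y => (f : Γ ⧸ N → k) (QuotientGroup.mk y), fun u y => by
    have hf := (Representation.mem_coindV _ _ _).1 f.2 ⟨QuotientGroup.mk (u : Γ), u.2⟩ (QuotientGroup.mk y)
    simpa using hf⟩
  map_add' _ _ := rfl
  map_smul' _ _ := rfl
  invFun g := ⟨Quotient.lift (g : Γ → k) (fun _ _ hab =>
      apply_eq_of_leftRel N U (g : Γ → k) ((Representation.mem_coindV _ _ _).1 g.2) hab), by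
    rintro ⟨q, hq⟩ x
    induction q using QuotientGroup.induction_on with | H u => ?_
    induction x using QuotientGroup.induction_on with | H y => ?_
    have hg := (Representation.mem_coindV _ _ _).1 g.2 ⟨u, hq⟩ y
    change (g : Γ → k) (u * y) = (g : Γ → k) y
    simpa using hg⟩
  left_inv f := by
    apply Subtype.ext
    funext x
    induction x using QuotientGroup.induction_on with | H y => ?_
    rfl
  right_inv g := rfl

/-- Formula: `(inflCoindTrivLinearEquiv N U f) y = f [y]`. [cite: Harari2020, §1.2] -/
@[simp]
theorem inflCoindTrivLinearEquiv_apply_coe (f : Representation.coindV U.subtype (triv (k := k) (Γ := U) k).obj.ρ)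
    (y : Γ) : (inflCoindTrivLinearEquiv (k := k) N U f : Γ → k) y = (f : Γ ⧸ N → k) (QuotientGroup.mk y) := rfl

end Vectors

/-! ## §3 The isomorphism in `C_Γ` and its Shapiro consequence -/

section Iso

variable {k Γ : Type u} [CommRing k] [Group Γ] [TopologicalSpace Γ] [IsTopologicalGroup Γ]
  (N : Subgroup Γ) [N.Normal] (U : Subgroup (Γ ⧸ N)) (hU : IsOpen (U : Set (Γ ⧸ N))) [U.FiniteIndex]
  [(comapQuot N U).FiniteIndex]
-- (the last instance is `finiteIndex_comapQuot N U`; it is carried as an argument so that the statements below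
-- mention door-c4's `coindD` for `Ũ` verbatim — supply it with `haveI := finiteIndex_comapQuot N U`)

include hU in
omit [IsTopologicalGroup Γ] [U.FiniteIndex] [(comapQuot N U).FiniteIndex] in
/-- `Ũ` is open. [cite: Harari2020, §4.3 Remark 4.24] -/
theorem isOpen_comapQuot : IsOpen (comapQuot N U : Set Γ) :=
  hU.preimage QuotientGroup.continuous_mk

/-- The isomorphism is equivariant: both actions are right translation of the argument.
[cite: Harari2020, §1.2 and §4.3 Remark 4.24] -/
theorem inflCoindTrivLinearEquiv_comm (γ : Γ) :
    (inflCoindTrivLinearEquiv (k := k) N U).toLinearMap ∘ₗ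
        ((((coindD k U hU).obj (triv (k := k) (Γ := U) k)).obj.ρ.comp (QuotientGroup.mk' N)) γ) =
      (((coindD k (comapQuot N U) (isOpen_comapQuot N U hU)).obj
          (triv (k := k) (Γ := comapQuot N U) k)).obj.ρ γ) ∘ₗ
        (inflCoindTrivLinearEquiv (k := k) N U).toLinearMap := by
  refine LinearMap.ext fun f => Subtype.ext (funext fun y => ?_)
  rfl

/-- **`Inf (Coind_U^{Γ/N} k) ≅ Coind_Ũ^Γ k` in `C_Γ`.** [cite: Harari2020, §1.2 and §4.3 Remark 4.24] -/
def inflCoindDTrivIso :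
    (inflQuotFunctor k N).obj ((coindD k U hU).obj (triv (k := k) (Γ := U) k)) ≅
      (coindD k (comapQuot N U) (isOpen_comapQuot N U hU)).obj (triv (k := k) (Γ := comapQuot N U) k) :=
  (isDiscrete k Γ).isoMk (Rep.mkIso
    (Representation.Equiv.mk (inflCoindTrivLinearEquiv (k := k) N U) (inflCoindTrivLinearEquiv_comm N U hU)))

/-- **Shapiro through the inflation**: `Extⁿ_{C_Γ}(Inf Coind_U k, Y) = 0` whenever `Extⁿ_{C_Ũ}(k, Res_Ũ Y) = 0`.
[cite: Harari2020, Proposition 1.39 and Remark 16.13] -/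
theorem ext_inflQuot_coindD_triv_eq_zero_of_forall (Y : DiscreteRepCat k Γ) (n : ℕ)
    (h : ∀ z : Ext (triv (k := k) (Γ := comapQuot N U) k) ((resD k (comapQuot N U)).obj Y) n, z = 0)
    (x : Ext ((inflQuotFunctor k N).obj ((coindD k U hU).obj (triv (k := k) (Γ := U) k))) Y n) : x = 0 := by
  set i := inflCoindDTrivIso (k := k) N U hU with hi
  -- transport to `Ext (Coind_Ũ k) Y n` along `i`, then Shapiro over `Γ`
  have hx : x = (Ext.mk₀ i.hom).comp ((Ext.mk₀ i.inv).comp x (zero_add n)) (zero_add n) := by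
    rw [Ext.mk₀_comp_mk₀_assoc, Iso.hom_inv_id, Ext.mk₀_id_comp]
  have h0 : (Ext.mk₀ i.inv).comp x (zero_add n) = 0 := by
    have := h (extCoindResAddEquiv (comapQuot N U) (isOpen_comapQuot N U hU)
      (triv (k := k) (Γ := comapQuot N U) k) Y n ((Ext.mk₀ i.inv).comp x (zero_add n)))
    exact (map_eq_zero_iff _ (extCoindResAddEquiv (comapQuot N U) (isOpen_comapQuot N U hU)
      (triv (k := k) (Γ := comapQuot N U) k) Y n).injective).1 this
  rw [hx, h0, Ext.comp_zero]

end Iso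

end DiscreteRep

end Literature.Algebra.Homology
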